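import Literature.NumberTheory.Sieve.RoughModelPairCorrelation
import Mathlib.Analysis.PSeries
import HarnessLib

/-!
# Tail sums over square-free moduli for the dispersion main part (Rankin's trick), PROVED

Topic `Literature/NumberTheory/Sieve`, namespace `Literature.NumberTheory.Sieve.CubicMinorant`
(`oddPrimesBelow z` of `RoughModelPairCorrelation.lean`).

In the main part `κ_z ∑_{t ⊆ S'} (∏_{p∈t}(p−2)⁻¹) Z(2∏t)` of the dispersion for `n = p + (x³+2y³)`
(tree `sum_sum_mul_pairSingSeries_eq`; parity-ideate route `GoldbachHeathBrownDispersion`, crux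
ModelDispersion) the moduli `d = ∏_{p∈t} p` beyond `Q₀` are controlled by RANKIN'S TRICK
`1[d > Q] ≤ (d/Q)^{1/2}` and an absolutely convergent Euler product, and the full range by a crude
polynomial bound.  We PROVE [HalberstamRichert1974, Ch. 2 §2 (2.3)–(2.4) (Rankin's trick for sums over
square-free `d ∣ P(z)`); MontgomeryVaughan2007, §7.1 (tails of convergent sums over square-free numbers)]:

* **`sum_powerset_filter_prod_gt_le`** — for `b ≥ 0` and `Q > 0`:
  `∑_{t ⊆ S, ∏t > Q} ∏_{p∈t} b_p ≤ Q^{−1/2} ∏_{p∈S} (1 + b_p √p)`;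
* `prod_one_add_le_exp_tsum` — `∏_{p∈S}(1 + g_p) ≤ exp(∑'_n g_n)` for a nonnegative summable `g`;
* **`exists_tail_sum_eighteen_div_sq_le`** — an absolute `C` with
  `∑_{t ⊆ S, ∏t > Q} ∏_{p∈t} 18/p² ≤ C/√Q` for every finite set `S` of naturals `≥ 1` and `Q > 0`;
* **`prod_oddPrimesBelow_one_add_three_div_le`** — `∏_{2<p<z} (1 + 3/(p−2)) ≤ z³` (`z ≥ 1`), by
  `1 + 3/j ≤ (1 + 1/j)³` and telescoping.

No new facts. Written for the parity-ideate cell (literature seat g14, 2026-08-27).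

## References

* [HalberstamRichert1974] H. Halberstam, H.-E. Richert, *Sieve Methods*, Ch. 2 §2 (2.3)–(2.4).
* [MontgomeryVaughan2007] H. L. Montgomery, R. C. Vaughan, *Multiplicative Number Theory I*, CUP 2007, §7.1.

## Mathlib / tree search

Mathlib: `Finset.prod_one_add`, `Real.add_one_le_exp`, `Real.exp_sum`, `Summable.sum_le_tsum`,
`Real.summable_nat_rpow_inv`, `Real.sqrt_eq_rpow`. Tree: `oddPrimesBelow`, `mem_oddPrimesBelow`.
-/

noncomputable section

open Finset
open Literature.NumberTheory.Sieve

namespace Literature.NumberTheory.Sieve.CubicMinorant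

/-! ### Rankin's trick over subsets -/

/-- **Rankin's trick over the subsets of a finite set**: for `b ≥ 0` on `S` and `Q > 0`,
`∑_{t ⊆ S, ∏_{p∈t} p > Q} ∏_{p∈t} b_p ≤ Q^{−1/2} ∏_{p∈S}(1 + b_p √p)`.
[cite: HalberstamRichert1974, Ch. 2 §2 (2.3)–(2.4) (Rankin's trick for sums over square-free d)] -/
theorem sum_powerset_filter_prod_gt_le (S : Finset ℕ) (b : ℕ → ℝ) (hb : ∀ p ∈ S, 0 ≤ b p)
    {Q : ℝ} (hQ : 0 < Q) :
    ∑ t ∈ S.powerset with Q < ∏ p ∈ t, ((p : ℕ) : ℝ), ∏ p ∈ t, b p ≤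
      (Real.sqrt Q)⁻¹ * ∏ p ∈ S, (1 + b p * Real.sqrt p) := by
  rw [prod_one_add, mul_sum]
  have hsQ : 0 < Real.sqrt Q := Real.sqrt_pos.mpr hQ
  calc ∑ t ∈ S.powerset with Q < ∏ p ∈ t, ((p : ℕ) : ℝ), ∏ p ∈ t, b p
      ≤ ∑ t ∈ S.powerset with Q < ∏ p ∈ t, ((p : ℕ) : ℝ),
          (Real.sqrt Q)⁻¹ * ∏ p ∈ t, (b p * Real.sqrt p) := by
        refine sum_le_sum fun t ht => ?_
        obtain ⟨htS, hQt⟩ := mem_filter.mp ht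
        have htS' : t ⊆ S := mem_powerset.mp htS
        have hb0 : 0 ≤ ∏ p ∈ t, b p := prod_nonneg fun p hp => hb p (htS' hp)
        have hsqrt : Real.sqrt Q ≤ ∏ p ∈ t, Real.sqrt p := by
          have h1 : Real.sqrt Q ≤ Real.sqrt (∏ p ∈ t, ((p : ℕ) : ℝ)) := Real.sqrt_le_sqrt hQt.le
          have h2 : ∏ p ∈ t, Real.sqrt p = Real.sqrt (∏ p ∈ t, ((p : ℕ) : ℝ)) := by
            rw [← Real.sqrt_sq (prod_nonneg (s := t) fun p _ => Real.sqrt_nonneg ((p : ℕ) : ℝ)), ← prod_pow]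
            congr 1
            exact prod_congr rfl fun p _ => Real.sq_sqrt (Nat.cast_nonneg p)
          rw [h2]; exact h1
        have hone : 1 ≤ (Real.sqrt Q)⁻¹ * ∏ p ∈ t, Real.sqrt p := by
          rw [← div_eq_inv_mul, le_div_iff₀ hsQ, one_mul]; exact hsqrt
        calc ∏ p ∈ t, b p = (∏ p ∈ t, b p) * 1 := (mul_one _).symm
          _ ≤ (∏ p ∈ t, b p) * ((Real.sqrt Q)⁻¹ * ∏ p ∈ t, Real.sqrt p) :=
              mul_le_mul_of_nonneg_left hone hb0
          _ = (Real.sqrt Q)⁻¹ * ∏ p ∈ t, (b p * Real.sqrt p) := by rw [prod_mul_distrib]; ring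
    _ ≤ ∑ t ∈ S.powerset, (Real.sqrt Q)⁻¹ * ∏ p ∈ t, (b p * Real.sqrt p) := by
        refine sum_le_sum_of_subset_of_nonneg (filter_subset _ _) fun t ht _ => ?_
        have htS' : t ⊆ S := mem_powerset.mp ht
        exact mul_nonneg (inv_nonneg.mpr hsQ.le)
          (prod_nonneg fun p hp => mul_nonneg (hb p (htS' hp)) (Real.sqrt_nonneg _))

/-- `∏_{p∈S}(1 + g_p) ≤ exp(∑'_n g_n)` for a nonnegative summable `g`.
[cite: MontgomeryVaughan2007, §7.1 (bounding a product over primes by the exponential of the sum)] -/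
theorem prod_one_add_le_exp_tsum (S : Finset ℕ) {g : ℕ → ℝ} (hg : ∀ n, 0 ≤ g n) (hs : Summable g) :
    ∏ p ∈ S, (1 + g p) ≤ Real.exp (∑' n, g n) := by
  calc ∏ p ∈ S, (1 + g p) ≤ ∏ p ∈ S, Real.exp (g p) :=
        prod_le_prod (fun p _ => by linarith [hg p]) fun p _ => by
          have := Real.add_one_le_exp (g p); linarith
    _ = Real.exp (∑ p ∈ S, g p) := (Real.exp_sum S g).symm
    _ ≤ Real.exp (∑' n, g n) := Real.exp_le_exp.mpr (hs.sum_le_tsum S fun n _ => hg n)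

/-- `√n/n² = (n^{3/2})⁻¹` on `ℕ` (with `0 ↦ 0` on both sides); hence `n ↦ 18√n/n²` is summable. [folklore] -/
private theorem summable_sqrt_div_sq : Summable (fun n : ℕ => 18 * (Real.sqrt n / (n : ℝ) ^ 2)) := by
  have h : (fun n : ℕ => Real.sqrt n / (n : ℝ) ^ 2) = fun n : ℕ => ((n : ℝ) ^ (3 / 2 : ℝ))⁻¹ := by
    funext n
    rcases Nat.eq_zero_or_pos n with hn | hn
    · subst hn; simp [Real.zero_rpow (by norm_num : (3 / 2 : ℝ) ≠ 0)]
    · have hn' : (0 : ℝ) < n := by exact_mod_cast hn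
      rw [Real.sqrt_eq_rpow, div_eq_iff (by positivity), ← Real.rpow_natCast,
        ← Real.rpow_neg hn'.le, ← Real.rpow_add hn']
      norm_num
  refine (summable_congr fun n => ?_).mpr
    ((Real.summable_nat_rpow_inv.mpr (by norm_num : (1 : ℝ) < 3 / 2)).mul_left 18)
  rw [congrFun h n]

/-- **The square-free tail beyond `Q` is `O(Q^{−1/2})`, absolutely**: there is `C > 0` with
`∑_{t ⊆ S, ∏_{p∈t} p > Q} ∏_{p∈t} 18/p² ≤ C/√Q` for every finite `S ⊆ ℕ` and `Q > 0`
(`C = exp(18 ∑_n n^{−3/2})`). [cite: HalberstamRichert1974, Ch. 2 §2 (2.3)–(2.4) (Rankin's trick for sums over square-free d)] -/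
theorem exists_tail_sum_eighteen_div_sq_le :
    ∃ C : ℝ, 0 < C ∧ ∀ (S : Finset ℕ) (Q : ℝ), 0 < Q →
      ∑ t ∈ S.powerset with Q < ∏ p ∈ t, ((p : ℕ) : ℝ), ∏ p ∈ t, ((18 : ℝ) / (p : ℝ) ^ 2) ≤
        C / Real.sqrt Q := by
  refine ⟨Real.exp (∑' n : ℕ, 18 * (Real.sqrt n / (n : ℝ) ^ 2)), Real.exp_pos _, fun S Q hQ => ?_⟩
  have hb : ∀ p ∈ S, 0 ≤ (18 : ℝ) / (p : ℝ) ^ 2 := fun p _ => by positivity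
  refine (sum_powerset_filter_prod_gt_le S _ hb hQ).trans ?_
  rw [div_eq_mul_inv, mul_comm (Real.exp _)]
  refine mul_le_mul_of_nonneg_left ?_ (inv_nonneg.mpr (Real.sqrt_nonneg Q))
  have hg : ∀ n : ℕ, 0 ≤ 18 * (Real.sqrt n / (n : ℝ) ^ 2) := fun n => by positivity
  refine le_trans (le_of_eq ?_) (prod_one_add_le_exp_tsum S hg summable_sqrt_div_sq)
  exact prod_congr rfl fun p _ => by ring

/-! ### The crude bound over the whole sifting range -/

/-- Telescoping: `∏_{3 ≤ k ≤ n} (k−1)/(k−2) = n − 1` for `n ≥ 2`. [folklore] -/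
private theorem prod_Icc_three_div (n : ℕ) (hn : 2 ≤ n) :
    ∏ k ∈ Icc 3 n, (((k : ℝ) - 1) / ((k : ℝ) - 2)) = (n : ℝ) - 1 := by
  induction n with
  | zero => omega
  | succ m ih =>
    rcases Nat.lt_or_ge m 2 with hm | hm
    · interval_cases m
      · omega
      · rw [show Icc 3 (1 + 1) = (∅ : Finset ℕ) by decide, prod_empty]; norm_num
    · rw [← Finset.insert_Icc_right_eq_Icc_add_one (by omega : 3 ≤ m + 1), prod_insert (by simp),
        ih hm]
      have hm2 : ((m + 1 : ℕ) : ℝ) - 2 ≠ 0 := by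
        have : (2 : ℝ) ≤ m := by exact_mod_cast hm
        push_cast; linarith
      field_simp
      push_cast
      ring

/-- **`∏_{2<p<z}(1 + 3/(p−2)) ≤ z³`** for `z ≥ 1` (`1 + 3/j ≤ ((j+1)/j)³` and telescoping over all
`3 ≤ k ≤ ⌈z⌉`). [cite: HalberstamRichert1974, Ch. 2 §2 (2.3)–(2.4) (crude bounds for products over the sifting range)] -/
theorem prod_oddPrimesBelow_one_add_three_div_le {z : ℝ} (hz : 1 ≤ z) :
    ∏ p ∈ oddPrimesBelow z, (1 + 3 / ((p : ℝ) - 2)) ≤ z ^ 3 := by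
  set n := ⌈z⌉₊ with hn
  have h3 : ∀ p ∈ oddPrimesBelow z, 3 ≤ p ∧ p < n := by
    intro p hp
    obtain ⟨hp2, hp'⟩ := mem_oddPrimesBelow.mp hp
    have hpp := Nat.prime_of_mem_primesBelow hp'
    refine ⟨?_, (Nat.mem_primesBelow.mp hp').1⟩
    rcases hpp.eq_two_or_odd' with h | h
    · exact absurd h hp2
    · have := hpp.two_le; rcases h with ⟨k, hk⟩; omega
  -- termwise `1 + 3/(p−2) ≤ ((p−1)/(p−2))³`
  have hterm : ∀ p ∈ oddPrimesBelow z,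
      1 + 3 / ((p : ℝ) - 2) ≤ (((p : ℝ) - 1) / ((p : ℝ) - 2)) ^ 3 := by
    intro p hp
    have hp3 : (3 : ℝ) ≤ p := by exact_mod_cast (h3 p hp).1
    have hj : 0 < (p : ℝ) - 2 := by linarith
    have e : 1 + 3 / ((p : ℝ) - 2) = ((p : ℝ) + 1) / ((p : ℝ) - 2) := by
      field_simp; ring
    rw [e, div_pow, div_le_div_iff₀ hj (pow_pos hj 3)]
    nlinarith [mul_nonneg hj.le (by linarith : (0 : ℝ) ≤ 3 * p - 5), sq_nonneg ((p : ℝ) - 2)]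
  have hnonneg : ∀ p ∈ oddPrimesBelow z, 0 ≤ 1 + 3 / ((p : ℝ) - 2) := by
    intro p hp
    have hp3 : (3 : ℝ) ≤ p := by exact_mod_cast (h3 p hp).1
    have : 0 ≤ 3 / ((p : ℝ) - 2) := div_nonneg (by norm_num) (by linarith)
    linarith
  have hz0 : (0 : ℝ) ≤ z := by linarith
  rcases Nat.lt_or_ge n 3 with hn3 | hn3
  · -- no odd primes below `z`
    have hempty : oddPrimesBelow z = ∅ := by
      rw [Finset.eq_empty_iff_forall_notMem]
      intro p hp
      have := h3 p hp
      omega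
    rw [hempty, prod_empty]
    exact one_le_pow₀ hz
  · have hsub : oddPrimesBelow z ⊆ Icc 3 n := by
      intro p hp
      have := h3 p hp
      rw [mem_Icc]; omega
    have hfac1 : ∀ k ∈ Icc 3 n, (1 : ℝ) ≤ ((k : ℝ) - 1) / ((k : ℝ) - 2) := by
      intro k hk
      have hk3 : (3 : ℝ) ≤ k := by exact_mod_cast (mem_Icc.mp hk).1
      rw [le_div_iff₀ (by linarith)]; linarith
    calc ∏ p ∈ oddPrimesBelow z, (1 + 3 / ((p : ℝ) - 2))
        ≤ ∏ p ∈ oddPrimesBelow z, (((p : ℝ) - 1) / ((p : ℝ) - 2)) ^ 3 := prod_le_prod hnonneg hterm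
      _ = (∏ p ∈ oddPrimesBelow z, ((p : ℝ) - 1) / ((p : ℝ) - 2)) ^ 3 := prod_pow _ 3 _
      _ ≤ (∏ k ∈ Icc 3 n, ((k : ℝ) - 1) / ((k : ℝ) - 2)) ^ 3 := by
          refine pow_le_pow_left₀ (prod_nonneg fun p hp => (zero_le_one.trans (hfac1 p (hsub hp)))) ?_ 3
          exact prod_le_prod_of_subset_of_one_le hsub
            (fun p hp => zero_le_one.trans (hfac1 p (hsub hp))) fun k hk _ => hfac1 k hk
      _ = ((n : ℝ) - 1) ^ 3 := by rw [prod_Icc_three_div n (by omega)]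
      _ ≤ z ^ 3 := by
          have hn1 : (n : ℝ) - 1 ≤ z := by
            have := Nat.ceil_lt_add_one hz0
            rw [← hn] at this
            linarith
          have hn0 : (0 : ℝ) ≤ (n : ℝ) - 1 := by
            have : (3 : ℝ) ≤ n := by exact_mod_cast hn3
            linarith
          exact pow_le_pow_left₀ hn0 hn1 3

end Literature.NumberTheory.Sieve.CubicMinorant

end
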